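import Literature.Computability.AlgebraicComplexity.AlmanLi2026ThreeByThree
import Literature.Computability.AlgebraicComplexity.AsymptoticRankMatMul
import Literature.Computability.AlgebraicComplexity.AsymptoticSpectrumDuality
import Literature.Computability.AlgebraicComplexity.AlmanLi2026ThreeByThreeProofs
import Literature.Computability.AlgebraicComplexity.AsymptoticRankAlgebraicExtension
import Literature.Computability.AlgebraicComplexity.BigCwFourthOmega
import Mathlib.Analysis.Complex.Polynomial.Basic
import HarnessLib

/-!
# `T ⊴ ⟨r⟩ ⊕ ⟨s,1,1⟩, ⟨r⟩ ⊕ ⟨1,s,1⟩, ⟨r⟩ ⊕ ⟨1,1,s⟩ ⟹ R̃(T) ≤ r + s^{ω/3}` (Alman–Li 2026,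
# Prop. 4.4, "toy example of Strassen calculus"), and Cor. 4.1 from Prop. 4.3 — modulo Strassen duality

Topic `Literature/Computability/AlgebraicComplexity`; sibling of `AlmanLi2026ThreeByThree.lean` (which
vendors Prop. 4.3 and Cor. 4.1 of the same paper as NAMED FACTS `AlmanLi2026_prop43`,
`AlmanLi2026_cor41`).  Here Prop. 4.4 is PROVED, following the printed proof, under the tree's named
fact `strassen_duality_asymptoticRank K` (Strassen duality for the asymptotic rank, CVZ 2023 Prop. 1.6
— `AsymptoticSpectrum.lean`; used the same way by the `MatrixMultiplication/AsymptoticSpectrum` and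
`HessianPlane` routes), and Cor. 4.1 over an algebraically closed field is DERIVED from the fact
`AlmanLi2026_prop43` + Prop. 4.4, as printed.  No new definition, no new named fact.

## Source, verbatim

J. Alman, B. Li, *Asymptotic Rank Speedup Theorems, Revisited*, arXiv:2605.21738 (2026) [AlmanLi2026],
read from the held text `paper:arxiv-2605.21738`, chunk p0010:

> (L12–L21) "Proposition 4.4. If tensor `T` satisfies the degeneration relations on three directions,
> `T ⊴ ⟨r⟩ ⊕ ⟨s,1,1⟩`, `T ⊴ ⟨r⟩ ⊕ ⟨1,s,1⟩`, `T ⊴ ⟨r⟩ ⊕ ⟨1,1,s⟩`, then its asymptotic rank satisfies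
> `R̃(T) ≤ r + s^{ω/3}`."
> (L23–L46, proof) "Step 1: Pass to asymptotic spectrum. Let `φ ∈ 𝒳` … `φ` is monotone—it preserves
> degenerations … `φ(T) ≤ φ(⟨r⟩ ⊕ ⟨s,1,1⟩)`. Using the additivity of `φ` … `φ(T) ≤ φ(⟨r⟩) + φ(⟨s,1,1⟩)`.
> Moreover, `φ` is normalized, so `φ(⟨r⟩) = r`. … `φ(⟨s,1,1⟩) = s^{θ₁}` … Step 2: … we take the minimum:
> `φ(T) ≤ r + min{s^{θ₁}, s^{θ₂}, s^{θ₃}}`. … `θ₁ + θ₂ + θ₃ ≤ ω`. We remind the reader that this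
> inequality essentially stems from the fact that `R̃(⟨n,n,n⟩) = n^ω`. … at least one must be less
> than or equal to the average `ω/3`, thus `φ(T) ≤ r + s^{(θ₁+θ₂+θ₃)/3} ≤ r + s^{ω/3}`. Final step: …
> By Strassen duality theorem, the asymptotic rank `R̃(T)` of `T` is the maximum of `φ(T)` over `𝒳`,
> so we get `R̃(T) ≤ r + s^{ω/3}`."
> (L49–L53) "Corollary 4.1. Any `3 × 3 × 3` tensor `T` has `R̃(T) ≤ 3 + 2^{ω/3}`. Proof. Since
> asymptotic rank is invariant under field extension [BCS13ACT], we may assume `𝔽` is algebraically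
> closed. Then by Prop. 4.3, we have `T ⊴ ⟨3⟩ ⊕ ⟨1,2,1⟩`. Applying Prop. 4.3 on the tensor with modes
> relabeled yields the other two degenerations required by Prop. 4.4. Thus we have
> `R̃(T) ≤ 3 + 2^{ω/3}`."

## Rendering (tree vocabulary, as in `AlmanLi2026ThreeByThree.lean`)

`⟨r⟩ = unitTensor K r`, `⊕ = directSumTensor`, `⊗ = kroneckerTensor`, `T ⊴ S` = `AlgDegeneratesTo S T`
(BCS degeneration, `DegenerationSpectralMonotone.lean`), `R̃ = asymptoticRank`, `ω = omega K`.  The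
paper's `⟨n,m,p⟩ = Σ x_{ij} y_{jk} z_{ki}` versus the tree's `matMulTensor k m n = Σ e_{κν} ⊗ e_{κμ} ⊗ e_{μν}`:
the three `s`-lines `⟨s,1,1⟩, ⟨1,s,1⟩, ⟨1,1,s⟩` (the shared index of size `s` sitting in the mode pairs
1–3, 1–2, 2–3 respectively) are the tree's `matMulTensor K 1 1 s`, `matMulTensor K s 1 1`,
`matMulTensor K 1 s 1` (shared index in modes 1–3, 1–2, 2–3); the hypothesis of Prop. 4.4 is the
symmetric SET of the three, so the correspondence of individual members is immaterial.  A point of the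
asymptotic spectrum is the tree's `IsUniversalSpectralPoint` (additive, multiplicative, normalised,
restriction-monotone; degeneration-monotone by `IsUniversalSpectralPoint.mono_of_algDegeneratesTo`).

## What is proved

* **`AlmanLi2026_prop44`** — Prop. 4.4 for `T` of any finite format over a field `K`, `s ≥ 1`,
  assuming `strassen_duality_asymptoticRank K`.  The printed Step 2 (`θ₁ + θ₂ + θ₃ ≤ ω`) is rendered
  without the parametrisation `θᵢ`: `φ(X)φ(Y)φ(Z) = φ(X ⊗ Y ⊗ Z) ≤ φ(⟨s,s,s⟩) ≤ R̃(⟨s,s,s⟩) = s^ω`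
  (`⟨s,s,s⟩ ≥ X ⊗ Y ⊗ Z` by relabelling, Bläser §5.2; `R̃(⟨s,s,s⟩) = s^ω` is the tree's
  `asymptoticRank_matMulTensor`; `φ ≤ R̃` is the easy half of the duality fact), whence
  `min φ(·)³ ≤ s^ω`.
* **`AlmanLi2026_cor41_of_prop43`** — Cor. 4.1 for `T : Fin 3 → Fin 3 → Fin 3 → F`, `F` algebraically
  closed, from `AlmanLi2026_prop43` and `strassen_duality_asymptoticRank F`; the "modes relabeled" step
  is carried out (`rotate`, the tree's cyclic permutation of the three factors, `FlatteningBound.lean`: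
  degenerations and restrictions rotate, `rotate (s ⊕ t) = rotate s ⊕ rotate t`, `rotate ⟨n⟩ = ⟨n⟩`,
  and `⟨m,n,k⟩ ≥ rotate ⟨k,m,n⟩`, Bläser Lemma 5.5 / tree `matMulTensor_rotate`);
  `AlmanLi2026_cor41_complex_of_prop43` (`F = ℂ`).

NOT formalised: the field-extension reduction of Cor. 4.1 (so the general-field fact
`AlmanLi2026_cor41` is not discharged here), Prop. 4.3 itself (generic-point/Zariski-closure argument),
Prop. 4.5 and §5–§7.

UPDATE (append 1, 2026-08-24): the three inputs named above as hypotheses / "not formalised" are all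
PROVED elsewhere in the tree — Strassen duality for `R̃` (`strassen_duality_asymptoticRank_holds`,
`AsymptoticSpectrumDuality.lean`), Prop. 4.3 (`AlmanLi2026_prop43_holds`,
`AlmanLi2026ThreeByThreeProofs.lean`) and the invariance of `R̃` under algebraic field extension
together with `ω(L) ≤ ω(K)` for `K ⊆ L` (`asymptoticRank_algebraicClosure`, `omega_le_omega_of_ringHom`,
`AsymptoticRankAlgebraicExtension.lean`, BCS Prop. (15.17) / (15.14)).  The final section of this file
feeds them in: `AlmanLi2026.prop44` (Prop. 4.4 with no duality hypothesis), `AlmanLi2026.cor41_of_isAlgClosed`,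
and the DISCHARGE **`AlmanLi2026_cor41_holds : AlmanLi2026_cor41`** (Cor. 4.1 over every field, exactly as
printed: pass to the algebraic closure `K̄`, where `R̃` is unchanged and `ω(K̄) ≤ ω(K)`).

## Mathlib / tree search

Tree, consumed by name: `strassen_duality_asymptoticRank`, `strassen_duality_asymptoticRank.asymptoticRank_le`,
`IsUniversalSpectralPoint` (`nonneg`, `map_directSum`, `map_kronecker`, `mono`) (`AsymptoticSpectrum`),
`IsUniversalSpectralPoint.mono_of_algDegeneratesTo`, `AlgDegeneratesTo`, `IsApproxRestriction`,
`TensorRestrictsTo.algDegeneratesTo_trans` (`DegenerationSpectralMonotone`), `TensorClass.evalRingHom_mk`,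
`TensorClass.natCast_eq_mk` (`TensorSemiringSpectrum`; `φ(⟨n⟩) = n`), `asymptoticRank_matMulTensor`
(`AsymptoticRankMatMul`), `tensorRestrictsTo_precomp`, `TensorRestrictsTo.trans` / `.refl` / `.directSum`
(`TensorRestrictionRank`, `TensorSemiring`), `matMulTensor_rotate` (`KroneckerRank`), `rotate`
(`FlatteningBound`), `AlmanLi2026_prop43` (`AlmanLi2026ThreeByThree`).  `lean search 'prop44|rotate_modes|
AlgDegeneratesTo.rotate'`: no prior statement of Prop. 4.4 or of degeneration-under-rotation in the tree
(`isApproxDecomposition_rotate` / `approxRank_rotate_le` in `SchoenhageTauBini` treat decompositions only).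

## References

* J. Alman, B. Li, *Asymptotic Rank Speedup Theorems, Revisited*, arXiv:2605.21738 (2026), Prop. 4.3,
  Prop. 4.4, Cor. 4.1 (`AlmanLi2026`).
* M. Christandl, P. Vrana, J. Zuiddam, *Universal points in the asymptotic spectrum of tensors*,
  J. AMS 36 (2023), §1.2, Prop. 1.6 (Strassen duality) (`ChristandlVranaZuiddam2023`).
* M. Bläser, *Fast Matrix Multiplication*, Theory of Computing Library, Graduate Surveys 5 (2013),
  §5.2, Lemma 5.5 (`Blaser2013`).
-/

noncomputable section

open scoped BigOperators

namespace Literature.Computability.AlgebraicComplexity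

universe u

variable {K : Type} [Field K]

/-! ## The three oriented `s`-lines multiply to `⟨s,s,s⟩` -/

/-- `⟨s,s,s⟩ ≥ ⟨s,1,1⟩ ⊗ (⟨1,s,1⟩ ⊗ ⟨1,1,s⟩)` (in the tree's `matMulTensor k m n` indexing; the product IS
`⟨s,s,s⟩` after relabelling, Bläser 2013 §5.2 "the tensor product of two matrix tensors is a bigger
matrix tensor"). [folklore] -/
private theorem tensorRestrictsTo_matMulTensor_kronecker_lines (s : ℕ) :
    TensorRestrictsTo (matMulTensor K s s s)
      (kroneckerTensor (matMulTensor K s 1 1)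
        (kroneckerTensor (matMulTensor K 1 s 1) (matMulTensor K 1 1 s))) := by
  have key : kroneckerTensor (matMulTensor K s 1 1)
        (kroneckerTensor (matMulTensor K 1 s 1) (matMulTensor K 1 1 s)) =
      fun a b c => matMulTensor K s s s (a.1.1, a.2.2.2) (b.1.1, b.2.1.2) (c.2.1.1, c.2.2.2) := by
    funext a b c
    obtain ⟨⟨a₁, a₂⟩, ⟨a₃, a₄⟩, ⟨a₅, a₆⟩⟩ := a
    obtain ⟨⟨b₁, b₂⟩, ⟨b₃, b₄⟩, ⟨b₅, b₆⟩⟩ := b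
    obtain ⟨⟨c₁, c₂⟩, ⟨c₃, c₄⟩, ⟨c₅, c₆⟩⟩ := c
    have e2 := Subsingleton.elim a₂ c₂
    have e3 := Subsingleton.elim a₃ b₃
    have e5 := Subsingleton.elim a₅ b₅
    have eb2 := Subsingleton.elim b₂ c₁
    have eb6 := Subsingleton.elim b₆ c₅
    have e4 := Subsingleton.elim a₄ c₄
    simp only [kroneckerTensor_apply, matMulTensor]
    by_cases h₁ : a₁ = b₁ <;> by_cases h₂ : b₄ = c₃ <;> by_cases h₃ : a₆ = c₆ <;>
      simp [h₁, h₂, h₃, e2, e3, e4, e5, eb2, eb6]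
  rw [key]
  exact tensorRestrictsTo_precomp (matMulTensor K s s s) _ _ _

/-! ## Prop. 4.4 -/

/-- A universal spectral point takes the value `n` on `⟨n⟩` (normalisation + additivity; via the
tree's `TensorClass.evalRingHom`). [cite: ChristandlVranaZuiddam2023, §1.2] -/
private theorem IsUniversalSpectralPoint.map_unitTensor' {F : SpectralMap K}
    (hF : IsUniversalSpectralPoint K F) (n : ℕ) : F (unitTensor K n) = n := by
  rw [← TensorClass.evalRingHom_mk hF, ← TensorClass.natCast_eq_mk, map_natCast]

/-- Step 1 of the printed proof, one direction: `T ⊴ ⟨r⟩ ⊕ X ⟹ φ(T) ≤ r + φ(X)` for a universal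
spectral point `φ` (monotone under degeneration, additive, normalised). [cite: AlmanLi2026, Prop. 4.4 (proof, Step 1)] -/
private theorem IsUniversalSpectralPoint.le_add_of_algDegeneratesTo {F : SpectralMap K}
    (hF : IsUniversalSpectralPoint K F) {ι κ μ ι' κ' μ' : Type} [Fintype ι] [Fintype κ] [Fintype μ]
    [Fintype ι'] [Fintype κ'] [Fintype μ'] {T : ι → κ → μ → K} {X : ι' → κ' → μ' → K} {r : ℕ}
    (h : AlgDegeneratesTo (directSumTensor (unitTensor K r) X) T) : F T ≤ r + F X := by
  have h1 := hF.mono_of_algDegeneratesTo h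
  rwa [hF.map_directSum, hF.map_unitTensor'] at h1

/-- **Alman–Li 2026, Proposition 4.4** ("toy example" of Strassen calculus): "If tensor `T` satisfies
the degeneration relations on three directions, `T ⊴ ⟨r⟩ ⊕ ⟨s,1,1⟩`, `T ⊴ ⟨r⟩ ⊕ ⟨1,s,1⟩`,
`T ⊴ ⟨r⟩ ⊕ ⟨1,1,s⟩`, then its asymptotic rank satisfies `R̃(T) ≤ r + s^{ω/3}`."  Here over a field
`K`, `T` of any finite format, the three `s`-lines being the tree's `matMulTensor K s 1 1`,
`matMulTensor K 1 s 1`, `matMulTensor K 1 1 s` (shared index in modes 1–2, 2–3, 1–3 respectively; the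
paper's `⟨1,s,1⟩`, `⟨1,1,s⟩`, `⟨s,1,1⟩` = `Σᵢ xᵢ₁y₁₁z₁ᵢ`), `⊕ = directSumTensor`, `⟨r⟩ = unitTensor K r`,
`⊴ = AlgDegeneratesTo`, and — as in the printed proof ("By Strassen duality theorem … the asymptotic rank
`R̃(T)` of `T` is the maximum of `φ(T)` over `𝒳`") — ASSUMING Strassen duality for the asymptotic rank,
the tree's named fact `strassen_duality_asymptoticRank K`.  Proof as printed: for a universal spectral
point `φ`, `φ(T) ≤ r + φ(X)`, `r + φ(Y)`, `r + φ(Z)` (monotonicity, additivity, `φ(⟨r⟩) = r`), and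
`φ(X)φ(Y)φ(Z) = φ(X ⊗ Y ⊗ Z) ≤ φ(⟨s,s,s⟩) ≤ R̃(⟨s,s,s⟩) = s^ω` (the paper's `θ₁ + θ₂ + θ₃ ≤ ω`), so
`min φ(·) ≤ s^{ω/3}`. Requires `s ≥ 1`. [cite: AlmanLi2026, Proposition 4.4] -/
theorem AlmanLi2026_prop44 (hSD : strassen_duality_asymptoticRank K) {ι κ μ : Type} [Fintype ι]
    [Fintype κ] [Fintype μ] (T : ι → κ → μ → K) {r s : ℕ} (hs : 1 ≤ s)
    (h₁ : AlgDegeneratesTo (directSumTensor (unitTensor K r) (matMulTensor K s 1 1)) T)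
    (h₂ : AlgDegeneratesTo (directSumTensor (unitTensor K r) (matMulTensor K 1 s 1)) T)
    (h₃ : AlgDegeneratesTo (directSumTensor (unitTensor K r) (matMulTensor K 1 1 s)) T) :
    asymptoticRank T ≤ r + (s : ℝ) ^ (omega K / 3) := by
  refine hSD.asymptoticRank_le T fun F hF => ?_
  set a := F (matMulTensor K s 1 1) with ha
  set b := F (matMulTensor K 1 s 1) with hb
  set c := F (matMulTensor K 1 1 s) with hc
  have ha0 : 0 ≤ a := hF.nonneg _
  have hb0 : 0 ≤ b := hF.nonneg _
  have hc0 : 0 ≤ c := hF.nonneg _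
  have hTa : F T ≤ r + a := hF.le_add_of_algDegeneratesTo h₁
  have hTb : F T ≤ r + b := hF.le_add_of_algDegeneratesTo h₂
  have hTc : F T ≤ r + c := hF.le_add_of_algDegeneratesTo h₃
  -- `a b c = φ(X ⊗ Y ⊗ Z) ≤ φ(⟨s,s,s⟩) ≤ R̃(⟨s,s,s⟩) = s^ω`
  have habc : a * (b * c) ≤ (s : ℝ) ^ omega K := by
    rw [ha, hb, hc, ← hF.map_kronecker, ← hF.map_kronecker]
    calc F (kroneckerTensor (matMulTensor K s 1 1)
            (kroneckerTensor (matMulTensor K 1 s 1) (matMulTensor K 1 1 s)))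
          ≤ F (matMulTensor K s s s) := hF.mono _ _ (tensorRestrictsTo_matMulTensor_kronecker_lines s)
      _ ≤ asymptoticRank (matMulTensor K s s s) := (hSD _).1 F hF
      _ = (s : ℝ) ^ omega K := asymptoticRank_matMulTensor K s hs
  -- the minimum `m` of `a, b, c` has `m³ ≤ abc ≤ s^ω`, so `m ≤ s^{ω/3}`
  set m := min a (min b c) with hm
  have hm0 : 0 ≤ m := le_min ha0 (le_min hb0 hc0)
  have hma : m ≤ a := min_le_left _ _
  have hmb : m ≤ b := (min_le_right _ _).trans (min_le_left _ _)
  have hmc : m ≤ c := (min_le_right _ _).trans (min_le_right _ _)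
  have hm3 : m ^ (3 : ℕ) ≤ (s : ℝ) ^ omega K := by
    calc m ^ (3 : ℕ) = m * (m * m) := by ring
      _ ≤ a * (b * c) := by gcongr
      _ ≤ (s : ℝ) ^ omega K := habc
  have hω : 0 ≤ omega K := le_trans (by norm_num) (omega_two_le (K := K))
  have hs0 : (0 : ℝ) ≤ s := Nat.cast_nonneg _
  have hmle : m ≤ (s : ℝ) ^ (omega K / 3) := by
    have h1 : (m ^ (3 : ℕ)) ^ ((1 : ℝ) / 3) ≤ ((s : ℝ) ^ omega K) ^ ((1 : ℝ) / 3) :=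
      Real.rpow_le_rpow (by positivity) hm3 (by norm_num)
    rw [← Real.rpow_natCast, ← Real.rpow_mul hm0, ← Real.rpow_mul hs0] at h1
    norm_num at h1
    rwa [div_eq_mul_one_div]
  have hTm : F T ≤ r + m := by
    rcases min_choice a (min b c) with h | h <;> [skip; rcases min_choice b c with h' | h'] 
    · rw [hm, h]; exact hTa
    · rw [hm, h, h']; exact hTb
    · rw [hm, h, h']; exact hTc
  linarith

/-! ## Cor. 4.1 over an algebraically closed field, from Prop. 4.3 + Prop. 4.4 ("modes relabeled") -/

section Rotate

open Polynomial

variable {ι κ μ ι' κ' μ' : Type}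

/-- Rotating the three modes of an approximate restriction. [folklore] -/
private theorem IsApproxRestriction.rotate_modes [Fintype ι] [Fintype κ] [Fintype μ] {h : ℕ}
    {s : ι → κ → μ → K} {t : ι' → κ' → μ' → K} {A : ι' → ι → K[X]} {B : κ' → κ → K[X]}
    {C : μ' → μ → K[X]} (hr : IsApproxRestriction h s t A B C) :
    IsApproxRestriction h (rotate s) (rotate t) B C A := by
  intro b' c' a' j hj
  have e1 : ∀ b c a, B b' b * C c' c * A a' a * Polynomial.C (rotate s b c a) =
      A a' a * B b' b * C c' c * Polynomial.C (s a b c) := fun b c a => by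
    rw [rotate_apply]; ring
  simp only [e1]
  rw [show (∑ b, ∑ c, ∑ a, A a' a * B b' b * C c' c * Polynomial.C (s a b c)) =
      ∑ a, ∑ b, ∑ c, A a' a * B b' b * C c' c * Polynomial.C (s a b c) from by
    rw [Finset.sum_congr rfl fun b _ => Finset.sum_comm, Finset.sum_comm], rotate_apply]
  exact hr a' b' c' j hj

/-- **Degeneration is compatible with relabelling the modes** (`t ⊴ s ⟹ πt ⊴ πs` for the cyclic
permutation `π` of the three factors). [folklore] -/
private theorem AlgDegeneratesTo.rotate_modes [Fintype ι] [Fintype κ] [Fintype μ] {s : ι → κ → μ → K}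
    {t : ι' → κ' → μ' → K} (h : AlgDegeneratesTo s t) : AlgDegeneratesTo (rotate s) (rotate t) := by
  obtain ⟨h, A, B, C, hd⟩ := h
  exact ⟨h, B, C, A, hd.rotate_modes⟩

/-- Restriction is compatible with relabelling the modes. [folklore] -/
private theorem TensorRestrictsTo.rotate_modes [Fintype ι] [Fintype κ] [Fintype μ] {s : ι → κ → μ → K}
    {t : ι' → κ' → μ' → K} (h : TensorRestrictsTo s t) :
    TensorRestrictsTo (_root_.Literature.Computability.AlgebraicComplexity.rotate s)
      (_root_.Literature.Computability.AlgebraicComplexity.rotate t) := by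
  -- (`rotate` is written fully qualified: importing `BigCwFourthOmega` brings the unrelated
  -- `TensorRestrictsTo.rotate` of `LaserSymmetrization.lean` into this theorem's namespace.)
  obtain ⟨A, B, C, hs⟩ := h
  refine ⟨B, C, A, fun b' c' a' => ?_⟩
  rw [rotate_apply, hs a' b' c', Finset.sum_comm]
  refine Finset.sum_congr rfl fun b _ => ?_
  rw [Finset.sum_comm]
  refine Finset.sum_congr rfl fun c _ => Finset.sum_congr rfl fun a _ => ?_
  rw [rotate_apply]; ring

omit [Field K] in
/-- `rotate (s ⊕ t) = rotate s ⊕ rotate t`. [folklore] -/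
private theorem rotate_directSumTensor [CommSemiring K] (s : ι → κ → μ → K) (t : ι' → κ' → μ' → K) :
    rotate (directSumTensor s t) = directSumTensor (rotate s) (rotate t) := by
  funext b c a
  rcases a with a | a <;> rcases b with b | b <;> rcases c with c | c <;> rfl

omit [Field K] in
/-- `rotate ⟨n⟩ = ⟨n⟩`. [folklore] -/
private theorem rotate_unitTensor [CommSemiring K] (n : ℕ) : rotate (unitTensor K n) = unitTensor K n := by
  funext b c a
  simp only [rotate_apply, unitTensor_apply]
  exact if_congr ⟨fun ⟨h1, h2⟩ => ⟨h2, (h1.trans h2).symm⟩, fun ⟨h1, h2⟩ => ⟨(h1.trans h2).symm, h1⟩⟩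
    rfl rfl

omit [Field K] in
/-- `⟨m,n,k⟩ ≥ rotate ⟨k,m,n⟩` (Bläser 2013, Lemma 5.5: the rotated matrix tensor is `⟨m,n,k⟩` after
swapping coordinates; tree `matMulTensor_rotate`). [cite: Blaser2013, Lemma 5.5] -/
private theorem tensorRestrictsTo_matMulTensor_rotate [CommSemiring K] (k m n : ℕ) :
    TensorRestrictsTo (matMulTensor K m n k) (rotate (matMulTensor K k m n)) := by
  have e : rotate (matMulTensor K k m n) =
      fun b c a => matMulTensor K m n k (Prod.swap b) c (Prod.swap a) := by
    funext b c a
    exact matMulTensor_rotate K k m n b c a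
  rw [e]
  exact tensorRestrictsTo_precomp (matMulTensor K m n k) Prod.swap id Prod.swap

end Rotate

/-- **Alman–Li 2026, Corollary 4.1 over an algebraically closed field, from Prop. 4.3 (named fact
`AlmanLi2026_prop43`) and Prop. 4.4** — the printed derivation: "by Prop. 4.3, we have
`T ⊴ ⟨3⟩ ⊕ ⟨1,2,1⟩`. Applying Prop. 4.3 on the tensor with modes relabeled yields the other two
degenerations required by Prop. 4.4. Thus we have `R̃(T) ≤ 3 + 2^{ω/3}`."  (The reduction to an
algebraically closed field — "asymptotic rank is invariant under field extension [BCS]" — is not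
formalised; hence `[IsAlgClosed F]`.)  Assumes Strassen duality, as Prop. 4.4 does.
[cite: AlmanLi2026, Corollary 4.1 (proof)] -/
theorem AlmanLi2026_cor41_of_prop43 (h43 : AlmanLi2026_prop43) (F : Type) [Field F] [IsAlgClosed F]
    (hSD : strassen_duality_asymptoticRank F) (T : Fin 3 → Fin 3 → Fin 3 → F) :
    asymptoticRank T ≤ 3 + (2 : ℝ) ^ (omega F / 3) := by
  -- the three placements of `⟨1,2,1⟩`
  have hA : AlgDegeneratesTo (directSumTensor (unitTensor F 3) (matMulTensor F 2 1 1)) T := h43 F T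
  have hC : AlgDegeneratesTo (directSumTensor (unitTensor F 3) (matMulTensor F 1 1 2)) T := by
    -- Prop. 4.3 for `rotate (rotate T)`, rotated once more (`rotate³ = id`)
    have h1 := (h43 F (rotate (rotate T))).rotate_modes
    rw [rotate_directSumTensor, rotate_unitTensor] at h1
    exact ((TensorRestrictsTo.refl _).directSum (tensorRestrictsTo_matMulTensor_rotate 2 1 1))
      |>.algDegeneratesTo_trans h1
  have hB : AlgDegeneratesTo (directSumTensor (unitTensor F 3) (matMulTensor F 1 2 1)) T := by
    -- Prop. 4.3 for `rotate T`, rotated twice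
    have h1 := ((h43 F (rotate T)).rotate_modes).rotate_modes
    rw [rotate_directSumTensor, rotate_directSumTensor, rotate_unitTensor, rotate_unitTensor] at h1
    have hres : TensorRestrictsTo (matMulTensor F 1 2 1) (rotate (rotate (matMulTensor F 2 1 1))) :=
      (tensorRestrictsTo_matMulTensor_rotate 1 1 2).trans
        (tensorRestrictsTo_matMulTensor_rotate 2 1 1).rotate_modes
    exact ((TensorRestrictsTo.refl _).directSum hres).algDegeneratesTo_trans h1
  have h := AlmanLi2026_prop44 hSD T (r := 3) (s := 2) (by norm_num) hA hB hC
  norm_num at h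
  exact h

/-- In particular over `ℂ` (the routes' field): **`R̃(T) ≤ 3 + 2^{ω(ℂ)/3}` for every
`T ∈ ℂ³ ⊗ ℂ³ ⊗ ℂ³`, from Prop. 4.3 and Strassen duality.** [cite: AlmanLi2026, Corollary 4.1] -/
theorem AlmanLi2026_cor41_complex_of_prop43 (h43 : AlmanLi2026_prop43)
    (hSD : strassen_duality_asymptoticRank ℂ) (T : Fin 3 → Fin 3 → Fin 3 → ℂ) :
    asymptoticRank T ≤ 3 + (2 : ℝ) ^ (omega ℂ / 3) :=
  AlmanLi2026_cor41_of_prop43 h43 ℂ hSD T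

/-! ## Unconditional forms and the discharge of Cor. 4.1 (append 1)

The hypotheses `hSD : strassen_duality_asymptoticRank K` and `h43 : AlmanLi2026_prop43` of the theorems
above are PROVED in the tree (`strassen_duality_asymptoticRank_holds`, `AsymptoticSpectrumDuality.lean`;
`AlmanLi2026_prop43_holds`, `AlmanLi2026ThreeByThreeProofs.lean`), and so is the field-extension step of the
printed proof of Cor. 4.1 ("Since asymptotic rank is invariant under field extension [BCS13ACT], we may
assume `𝔽` is algebraically closed", p0010 L50–L51): `asymptoticRank_algebraicClosure` (`R̃_K(t) =
R̃_{K̄}(t_{K̄})`, BCS Prop. (15.17)) and `omega_le_omega_of_ringHom` (`ω(K̄) ≤ ω(K)`, BCS (15.14)) of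
`AsymptoticRankAlgebraicExtension.lean`.  Feeding them in gives the statements with no hypotheses. -/

/-- **Alman–Li 2026, Proposition 4.4, unconditionally** (Strassen duality supplied by the tree's
`strassen_duality_asymptoticRank_holds`): `T ⊴ ⟨r⟩ ⊕ ⟨s,1,1⟩, ⟨r⟩ ⊕ ⟨1,s,1⟩, ⟨r⟩ ⊕ ⟨1,1,s⟩`
(`s ≥ 1`, the three `s`-lines in the tree's indexing as in `AlmanLi2026_prop44`) implies
`R̃(T) ≤ r + s^{ω/3}`. [cite: AlmanLi2026, Proposition 4.4] -/
theorem AlmanLi2026.prop44 {ι κ μ : Type} [Fintype ι] [Fintype κ] [Fintype μ] (T : ι → κ → μ → K)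
    {r s : ℕ} (hs : 1 ≤ s)
    (h₁ : AlgDegeneratesTo (directSumTensor (unitTensor K r) (matMulTensor K s 1 1)) T)
    (h₂ : AlgDegeneratesTo (directSumTensor (unitTensor K r) (matMulTensor K 1 s 1)) T)
    (h₃ : AlgDegeneratesTo (directSumTensor (unitTensor K r) (matMulTensor K 1 1 s)) T) :
    asymptoticRank T ≤ r + (s : ℝ) ^ (omega K / 3) :=
  AlmanLi2026_prop44 (strassen_duality_asymptoticRank_holds K) T hs h₁ h₂ h₃

/-- **Alman–Li 2026, Corollary 4.1 over an algebraically closed field, unconditionally**: every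
`T : Fin 3 → Fin 3 → Fin 3 → F`, `F` algebraically closed, has `R̃(T) ≤ 3 + 2^{ω(F)/3}` — Prop. 4.3
(`AlmanLi2026_prop43_holds`) in the three mode orders and Prop. 4.4, as printed.
[cite: AlmanLi2026, Corollary 4.1 (proof)] -/
theorem AlmanLi2026.cor41_of_isAlgClosed (F : Type) [Field F] [IsAlgClosed F]
    (T : Fin 3 → Fin 3 → Fin 3 → F) : asymptoticRank T ≤ 3 + (2 : ℝ) ^ (omega F / 3) :=
  AlmanLi2026_cor41_of_prop43 AlmanLi2026_prop43_holds F (strassen_duality_asymptoticRank_holds F) T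

/-- **Alman–Li 2026, Corollary 4.1** — DISCHARGE of the named fact `AlmanLi2026_cor41` of
`AlmanLi2026ThreeByThree.lean`: over ANY field `𝔽`, every tensor `T ∈ 𝔽³ ⊗ 𝔽³ ⊗ 𝔽³` has
`R̃(T) ≤ 3 + 2^{ω/3}` (`ω = ω(𝔽)`).  Proof exactly as printed (p0010 L50–L53): "Since asymptotic rank
is invariant under field extension [BCS13ACT], we may assume `𝔽` is algebraically closed" — here
`R̃_𝔽(T) = R̃_{𝔽̄}(T_{𝔽̄})` (`asymptoticRank_algebraicClosure`) `≤ 3 + 2^{ω(𝔽̄)/3}`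
(`AlmanLi2026.cor41_of_isAlgClosed`) `≤ 3 + 2^{ω(𝔽)/3}` (`ω(𝔽̄) ≤ ω(𝔽)`, `omega_le_omega_of_ringHom`).
[cite: AlmanLi2026, Corollary 4.1] -/
theorem AlmanLi2026_cor41_holds : AlmanLi2026_cor41 := by
  intro F _ T
  rw [← asymptoticRank_algebraicClosure T]
  refine (AlmanLi2026.cor41_of_isAlgClosed (AlgebraicClosure F) _).trans ?_
  have hω : omega (AlgebraicClosure F) ≤ omega F :=
    omega_le_omega_of_ringHom (algebraMap F (AlgebraicClosure F))
  have h2 : (2 : ℝ) ^ (omega (AlgebraicClosure F) / 3) ≤ (2 : ℝ) ^ (omega F / 3) :=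
    Real.rpow_le_rpow_of_exponent_le (by norm_num) (by linarith)
  linarith

/-- The complex case, unconditionally: every `T : Fin 3 → Fin 3 → Fin 3 → ℂ` has
`R̃(T) ≤ 3 + 2^{ω(ℂ)/3}` (the statement `AlmanLi2026_cor41.complex` fed with the discharge).
[cite: AlmanLi2026, Corollary 4.1] -/
theorem AlmanLi2026.cor41_complex (T : Fin 3 → Fin 3 → Fin 3 → ℂ) :
    asymptoticRank T ≤ 3 + (2 : ℝ) ^ (omega ℂ / 3) :=
  AlmanLi2026_cor41_holds.complex T

/-! ## APPEND 2 (numeric form of Cor. 4.1 with the tree's kernel bound `ω ≤ 2.37295`)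

p0010 L56: "Numerically, using the current upper bound for `ω`, we have `3 + 2^{ω/3} < 4.7297`."  The
printed `4.7297` uses the refereed record `ω < 2.371339` (ADVXXZ 2025), which the tree holds only as a
named fact; with the tree's KERNEL bound `LeGall2014_cw4_omega_le : ω(K) ≤ 2.37295`
(`BigCwFourthOmega.lean`) one gets `3 + 2^{2.37295/3} = 4.7302… < 4.731`, unconditionally, over every
field. -/

/-- `2^{53/67} < 1.731` (`2^53 < 1.731^67`; `53/67 = 0.79104… > 2.37295/3 = 0.79098…`). [folklore] -/
private theorem two_rpow_lt_1731 : (2 : ℝ) ^ ((53 : ℝ) / 67) < 1.731 := by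
  have h67 : (0 : ℝ) < 67 := by norm_num
  have hx : (0 : ℝ) ≤ (2 : ℝ) ^ ((53 : ℝ) / 67) := by positivity
  have key : ((2 : ℝ) ^ ((53 : ℝ) / 67)) ^ (67 : ℕ) < (1.731 : ℝ) ^ (67 : ℕ) := by
    rw [← Real.rpow_natCast, ← Real.rpow_mul (by norm_num : (0 : ℝ) ≤ 2)]
    norm_num
  exact lt_of_pow_lt_pow_left₀ 67 (by norm_num) key

/-- **Alman–Li 2026, Cor. 4.1, numerically, at kernel grade: every `3 × 3 × 3` tensor over every field
has `R̃(T) < 4.731`** (`3 + 2^{ω/3} ≤ 3 + 2^{2.37295/3} < 4.731`, from the discharge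
`AlmanLi2026_cor41_holds` and the tree's kernel bound `ω ≤ 2.37295`; the printed `< 4.7297` needs the
record `ω < 2.371339`, a named fact in the tree).
[cite: AlmanLi2026, Corollary 4.1 and p. 10 ("Numerically … 3 + 2^{ω/3} < 4.7297")] -/
theorem AlmanLi2026.cor41_lt_4731 (F : Type) [Field F] (T : Fin 3 → Fin 3 → Fin 3 → F) :
    asymptoticRank T < 4.731 := by
  have h1 := AlmanLi2026_cor41_holds F T
  have hω := LeGall2014_cw4_omega_le F
  have h2 : (2 : ℝ) ^ (omega F / 3) ≤ (2 : ℝ) ^ ((53 : ℝ) / 67) :=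
    Real.rpow_le_rpow_of_exponent_le (by norm_num) (by linarith)
  have h3 := two_rpow_lt_1731
  linarith

end Literature.Computability.AlgebraicComplexity

end
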